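import Summits.Ventures.Crystal3D.Theorems.StickyWulffConstantCoaxialWallLawSeamFullCensusChecker
import HarnessLib

/-!
# FULL-CENSUS FREE BALL: the model dictionary (`Q3` ↔ `Fin 3 → ℚ`) and the FREE-BALL lemma (the eleventh contact of the end ball is pinned to three model positions)
# (crux `CoaxialWallLaw`, stmt-Ventures-19481; lane F 'Certificates' v8.4, registered stub `stub_satCensus11Full : TailResidue.SatCensus11Full`)

HONEST FRAMING. Venture `Summits/Ventures/Crystal3D` (cell `crystal3d-full`); helper for `stub_satCensus11Full`; sequel of '…SeamFullCensusChecker'.  §1 dictionary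
lemmas between the checker's triples `Q3` and the rational model (`toV`, `dq`, distances under `T`); §2 **`free_ball`** — in the one E1-silent state of the cascade
(seat 19481-p2 g15, exact search: reader `q` full, its four common neighbours with `b` twinned on three `{111}` planes, ten contacts of `b` known — the five balls with
known dozens, four SATURATED hexagon-type balls, one unsaturated mirror ball) the eleventh contact of `b` is one of THREE model points.  Elementary: GAP(5/2) at the
nine saturated balls makes its direction `x` (`x·x = 2`) satisfy linear constraints `x·v ≤ 7/16` / `x·v = 1`, a system with exactly three solutions (`free_core`:
two contact cases are quadratic with rational roots, the all-far case lies in a box inside the open ball of radius `√2`).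
WHAT THIS IS NOT: no census statement is proved here; F-C1 not moved.
-/

noncomputable section

namespace Summit.Ventures.Crystal3D.Theorems

namespace TailResidue

namespace FullCensus

open Summit.Ventures.Crystal3D Finset EndRowFloor NearIdentity
open scoped InnerProductSpace

variable {X : Finset (EuclideanSpace ℝ (Fin 3))} (G' : EuclideanSpace ℝ (Fin 3) ≃ₗᵢ[ℝ] EuclideanSpace ℝ (Fin 3)) (q₀ : EuclideanSpace ℝ (Fin 3))

/-! ### §1 Dictionary -/

namespace Q3

/-- Components of `toV`. -/
theorem toV_apply (a : Q3) : a.toV 0 = a.x ∧ a.toV 1 = a.y ∧ a.toV 2 = a.z := by simp [toV]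

/-- `toV` is additive. -/
theorem toV_add (a b : Q3) : (Q3.add a b).toV = a.toV + b.toV := by
  ext i; fin_cases i <;> simp [toV, Q3.add]

/-- `toV` respects subtraction. -/
theorem toV_sub (a b : Q3) : (Q3.sub a b).toV = a.toV - b.toV := by
  ext i; fin_cases i <;> simp [toV, Q3.sub]

/-- `toV` respects scaling. -/
theorem toV_smul (r : ℚ) (a : Q3) : (Q3.smul r a).toV = r • a.toV := by
  ext i; fin_cases i <;> simp [toV, Q3.smul]

/-- `dq` on `toV` is `Q3.dot`. -/
theorem dq_toV (a b : Q3) : dq a.toV b.toV = Q3.dot a b := by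
  simp [dq, toV, Q3.dot]

/-- Squared model distance. -/
theorem dq_toV_sub (a b : Q3) : dq (a.toV - b.toV) (a.toV - b.toV) = Q3.d2 a b := by
  rw [← toV_sub, dq_toV]; rfl

/-- `toV` is injective. -/
theorem toV_injective : Function.Injective Q3.toV := by
  intro a b h
  have h0 := congrFun h 0; have h1 := congrFun h 1; have h2 := congrFun h 2
  simp only [toV, Matrix.cons_val_zero, Matrix.cons_val_one, Matrix.cons_val] at h0 h1 h2
  cases a; cases b; simp_all

/-- `d2` is symmetric. -/
theorem d2_comm (a b : Q3) : Q3.d2 a b = Q3.d2 b a := by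
  simp only [Q3.d2, Q3.dot, Q3.sub]; ring

end Q3

/-- The ball of `X` at the model triple `a`. -/
abbrev TT (a : Q3) : EuclideanSpace ℝ (Fin 3) := T G' q₀ a.toV

/-- `TT` is injective. -/
theorem TT_injective : Function.Injective (TT G' q₀) := fun _ _ h => Q3.toV_injective (T_injective G' q₀ h)

/-- `dist (TT a) (TT b) = 1 ↔ d2 a b = 18`. -/
theorem dist_TT_eq_one_iff (a b : Q3) : dist (TT G' q₀ a) (TT G' q₀ b) = 1 ↔ Q3.d2 a b = 18 := by
  rw [TT, TT, dist_T_eq_one_iff, Q3.dq_toV_sub]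

/-- `1 ≤ dist (TT a) (TT b) ↔ 18 ≤ d2 a b`. -/
theorem one_le_dist_TT_iff (a b : Q3) : 1 ≤ dist (TT G' q₀ a) (TT G' q₀ b) ↔ 18 ≤ Q3.d2 a b := by
  rw [TT, TT, one_le_dist_T_iff, Q3.dq_toV_sub]

/-- `TT (a + v) = TT a + G' (Qr (iptQ v.toV))`. -/
theorem TT_add (a v : Q3) : TT G' q₀ (Q3.add a v) = TT G' q₀ a + G' (Qr (iptQ v.toV)) := by
  simp only [TT, T, Q3.toV_add, PQ_add, map_add, add_assoc]

/-! ### §2 The free-ball lemma -/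

/-- Inner products of model points after the tilt: `⟪Qr (iptQ u), Qr (iptQ v)⟫ = dq u v / 18`. -/
theorem inner_Qr_iptQ (u v : Fin 3 → ℚ) : ⟪Qr (iptQ u), Qr (iptQ v)⟫_ℝ = (dq u v : ℝ) / 18 := by
  rw [Qr.inner_map_map, inner_iptQ]

/-- **Coordinates of a unit vector against the tilted model basis.**  For `u` with `‖u‖ = 1` and `Φ = Qr` followed by `G'`: the numbers
`x i = √2 · (Φ⁻¹ u) i` satisfy `x·x = 2` and `⟪u, G' (Qr (iptQ v))⟫ = (Σ x i v i) / 6` for every rational `v`. -/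
theorem coords_of_unit {u : EuclideanSpace ℝ (Fin 3)} (hu : ‖u‖ = 1) :
    ∃ x : Fin 3 → ℝ, x 0 ^ 2 + x 1 ^ 2 + x 2 ^ 2 = 2 ∧
      (∀ v : Fin 3 → ℚ, ⟪u, G' (Qr (iptQ v))⟫_ℝ = (x 0 * v 0 + x 1 * v 1 + x 2 * v 2) / 6) ∧
      ∀ v : Fin 3 → ℚ, (∀ i, x i = (v i : ℝ)) → u = G' (Qr (iptQ ((3 : ℚ) • v))) := by
  set c : EuclideanSpace ℝ (Fin 3) := (Qr.trans G').symm u with hc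
  have huc : u = (Qr.trans G') c := by rw [hc, LinearIsometryEquiv.apply_symm_apply]
  have hcn : ‖c‖ = 1 := by rw [hc, LinearIsometryEquiv.norm_map, hu]
  have hcc : c 0 ^ 2 + c 1 ^ 2 + c 2 ^ 2 = 1 := by
    have h := hcn
    rw [EuclideanSpace.norm_eq, Real.sqrt_eq_one, Fin.sum_univ_three] at h
    simp only [Real.norm_eq_abs, sq_abs] at h
    exact h
  have h2 : Real.sqrt 2 ^ 2 = 2 := Real.sq_sqrt (by norm_num)
  have h18 : Real.sqrt 18 = 3 * Real.sqrt 2 := by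
    rw [show (18 : ℝ) = 3 ^ 2 * 2 by norm_num, Real.sqrt_mul (by norm_num), Real.sqrt_sq (by norm_num)]
  have hinv : (Real.sqrt 18)⁻¹ = Real.sqrt 2 / 6 := by
    have h22 : Real.sqrt 2 * Real.sqrt 2 = 2 := Real.mul_self_sqrt (by norm_num)
    have hs0 : (3 * Real.sqrt 2 : ℝ) ≠ 0 := by positivity
    rw [h18, eq_div_iff (by norm_num : (6 : ℝ) ≠ 0)]
    calc (3 * Real.sqrt 2)⁻¹ * 6 = (3 * Real.sqrt 2)⁻¹ * (3 * Real.sqrt 2) * Real.sqrt 2 := by rw [mul_assoc, mul_assoc, h22]; ring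
      _ = Real.sqrt 2 := by rw [inv_mul_cancel₀ hs0, one_mul]
  refine ⟨fun i => Real.sqrt 2 * c i, ?_, fun v => ?_, fun v hv => ?_⟩
  · nlinarith [hcc, h2]
  · rw [huc, LinearIsometryEquiv.trans_apply, G'.inner_map_map, Qr.inner_map_map]
    simp only [PiLp.inner_apply, iptQ_apply, Fin.sum_univ_three, RCLike.inner_apply, conj_trivial, hinv]
    ring
  · rw [huc, LinearIsometryEquiv.trans_apply]
    have hc' : c = iptQ ((3 : ℚ) • v) := by
      ext i
      rw [iptQ_apply, hinv]
      have hi : Real.sqrt 2 * c i = (v i : ℝ) := hv i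
      simp only [Pi.smul_apply, smul_eq_mul, Rat.cast_mul, Rat.cast_ofNat]
      have h22 : Real.sqrt 2 * Real.sqrt 2 = 2 := Real.mul_self_sqrt (by norm_num)
      have : c i = Real.sqrt 2 * (v i : ℝ) / 2 := by
        rw [← hi, ← mul_assoc, h22]; ring
      rw [this]; ring
    rw [hc']

/-- **The algebraic core of the free-ball lemma** (`σ = 1` after the sign change): the direction `x` (`x·x = 2`) of an eleventh contact, at gap-distance from the
five balls with known dozens (`x·v ≤ 7/16`), at contact-or-gap distance from the four saturated far balls (`x·v = 1 ∨ x·v ≤ 7/16`) and at distance `≥ 1` from the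
unsaturated mirror ball (`x·v ≤ 1`), is one of three vectors. -/
theorem free_core (x1 x2 x3 : ℝ) (hs : x1 ^ 2 + x2 ^ 2 + x3 ^ 2 = 2)
    (hq : -x1 - x2 ≤ 7 / 16) (hnA : -x2 + x3 ≤ 7 / 16) (hnB : -x1 + x3 ≤ 7 / 16) (hnC : -x2 - x3 ≤ 7 / 16) (hnD : -x1 - x3 ≤ 7 / 16)
    (heA : x1 - x2 = 1 ∨ x1 - x2 ≤ 7 / 16) (heB : x2 - x1 = 1 ∨ x2 - x1 ≤ 7 / 16) (hfA : x1 + x3 = 1 ∨ x1 + x3 ≤ 7 / 16) (hfB : x2 + x3 = 1 ∨ x2 + x3 ≤ 7 / 16)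
    (hm : x1 + x2 - 4 * x3 ≤ 3) :
    (x1 = 1 ∧ x2 = 1 ∧ x3 = 0) ∨ (x1 = 1 / 3 ∧ x2 = 4 / 3 ∧ x3 = -1 / 3) ∨ (x1 = 4 / 3 ∧ x2 = 1 / 3 ∧ x3 = -1 / 3) := by
  rcases hfA with hA | hA <;> rcases hfB with hB | hB
  · -- both far balls f_A, f_B in contact: x1 = x2 = 1 − x3, 3 x3² = 4 x3
    have hx1 : x1 = 1 - x3 := by linarith
    have hx2 : x2 = 1 - x3 := by linarith
    subst hx1; subst hx2
    have h3 : x3 * (3 * x3 - 4) = 0 := by nlinarith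
    rcases mul_eq_zero.1 h3 with h | h
    · left; refine ⟨by linarith, by linarith, h⟩
    · exfalso; have : x3 = 4 / 3 := by linarith
      subst this; norm_num at hnA
  · -- f_A contact, f_B far
    have hx1 : x1 = 1 - x3 := by linarith
    subst hx1
    rcases heA with hE | hE
    · have hx2 : x2 = -x3 := by linarith
      subst hx2
      have h3 : (3 * x3 + 1) * (x3 - 1) = 0 := by nlinarith
      rcases mul_eq_zero.1 h3 with h | h
      · right; right; refine ⟨by linarith, by linarith, by linarith⟩
      · exfalso; have : x3 = 1 := by linarith
        subst this; norm_num at hnA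
    · exfalso; linarith
  · -- f_A far, f_B contact
    have hx2 : x2 = 1 - x3 := by linarith
    subst hx2
    rcases heB with hE | hE
    · have hx1 : x1 = -x3 := by linarith
      subst hx1
      have h3 : (3 * x3 + 1) * (x3 - 1) = 0 := by nlinarith
      rcases mul_eq_zero.1 h3 with h | h
      · right; left; refine ⟨by linarith, by linarith, by linarith⟩
      · exfalso; have : x3 = 1 := by linarith
        subst this; norm_num at hnB
    · exfalso; linarith
  · -- both far: the direction lies in a polytope inside the open ball of radius √2
    rcases heA with hE | hE
    · exfalso; linarith
    rcases heB with hE' | hE'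
    · exfalso; linarith
    exfalso
    have b1 : x1 ≤ 83 / 96 := by linarith
    have b1' : -7 / 16 ≤ x1 := by linarith
    have b2 : x2 ≤ 83 / 96 := by linarith
    have b2' : -7 / 16 ≤ x2 := by linarith
    have b3 : x3 ≤ 7 / 16 := by linarith
    have b3' : -31 / 48 ≤ x3 := by linarith
    nlinarith [mul_nonneg (sub_nonneg.2 b1) (sub_nonneg.2 b1'), mul_nonneg (sub_nonneg.2 b2) (sub_nonneg.2 b2'),
      mul_nonneg (sub_nonneg.2 b3) (sub_nonneg.2 b3')]

/-- The free-ball core in physical orientation: the sign `σ = ±1` of the variant enters the two far balls `f_A, f_B` and the mirror ball. -/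
theorem free_phys (σ : ℝ) (hσ : σ = 1 ∨ σ = -1) (x0 x1 x2 : ℝ) (hs : x0 ^ 2 + x1 ^ 2 + x2 ^ 2 = 2)
    (hq : -x0 - x1 ≤ 7 / 16) (hnA : -x1 + x2 ≤ 7 / 16) (hnC : -x1 - x2 ≤ 7 / 16) (hnB : -x0 + x2 ≤ 7 / 16) (hnD : -x0 - x2 ≤ 7 / 16)
    (heA : x0 - x1 = 1 ∨ x0 - x1 ≤ 7 / 16) (heB : x1 - x0 = 1 ∨ x1 - x0 ≤ 7 / 16)
    (hfA : x0 + σ * x2 = 1 ∨ x0 + σ * x2 ≤ 7 / 16) (hfB : x1 + σ * x2 = 1 ∨ x1 + σ * x2 ≤ 7 / 16) (hm : x0 + x1 - 4 * (σ * x2) ≤ 3) :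
    (x0 = 1 ∧ x1 = 1 ∧ x2 = 0) ∨ (x0 = 1 / 3 ∧ x1 = 4 / 3 ∧ x2 = -σ / 3) ∨ (x0 = 4 / 3 ∧ x1 = 1 / 3 ∧ x2 = -σ / 3) := by
  rcases hσ with rfl | rfl
  · simp only [one_mul] at hfA hfB hm
    rcases free_core x0 x1 x2 hs hq hnA hnB hnC hnD heA heB hfA hfB hm with ⟨h0, h1, h2⟩ | ⟨h0, h1, h2⟩ | ⟨h0, h1, h2⟩
    · exact Or.inl ⟨h0, h1, h2⟩
    · exact Or.inr (Or.inl ⟨h0, h1, by linarith⟩)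
    · exact Or.inr (Or.inr ⟨h0, h1, by linarith⟩)
  · simp only [neg_mul, one_mul] at hfA hfB hm
    have hs' : x0 ^ 2 + x1 ^ 2 + (-x2) ^ 2 = 2 := by nlinarith
    rcases free_core x0 x1 (-x2) hs' hq (by linarith) (by linarith) (by linarith) (by linarith) heA heB hfA hfB (by linarith) with
      ⟨h0, h1, h2⟩ | ⟨h0, h1, h2⟩ | ⟨h0, h1, h2⟩
    · exact Or.inl ⟨h0, h1, by linarith⟩
    · exact Or.inr (Or.inl ⟨h0, h1, by linarith⟩)
    · exact Or.inr (Or.inr ⟨h0, h1, by linarith⟩)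

open scoped Classical in
/-- **THE FREE-BALL LEMMA.**  Reader `q = 0` and the four common neighbours with known dozens whose contacts of `b` lie among the ten listed balls (`kList`,
saturated), the four far balls `sList σ` saturated, the mirror ball `m0 σ` present; then any contact `z` of `b = TT bQ` other than the ten is
`TT ⟨6,6,0⟩`, `TT ⟨4,7,−σ⟩` or `TT ⟨7,4,−σ⟩`. -/
theorem free_ball (hg : KissingGap (5 / 2)) (hX : ∀ p ∈ X, ∀ p' ∈ X, p ≠ p' → 1 ≤ dist p p') {σ : ℚ} (hσ : σ = 1 ∨ σ = -1)
    (hK : ∀ k ∈ kList, TT G' q₀ k ∈ X ∧ (X.filter fun z => dist (TT G' q₀ k) z = 1).card = 12 ∧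
      ∀ z ∈ X, dist (TT G' q₀ k) z = 1 → dist (TT G' q₀ bQ) z = 1 → ∃ u ∈ tenList σ, z = TT G' q₀ u)
    (hS : ∀ s ∈ sList σ, TT G' q₀ s ∈ X ∧ (X.filter fun z => dist (TT G' q₀ s) z = 1).card = 12) (hm : TT G' q₀ (m0 σ) ∈ X)
    {z : EuclideanSpace ℝ (Fin 3)} (hz : z ∈ X) (hzb : dist (TT G' q₀ bQ) z = 1) (hnew : ∀ u ∈ tenList σ, z ≠ TT G' q₀ u) :
    z = TT G' q₀ ⟨6, 6, 0⟩ ∨ z = TT G' q₀ ⟨4, 7, -σ⟩ ∨ z = TT G' q₀ ⟨7, 4, -σ⟩ := by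
  -- the direction of `z` from `b`
  set u := z - TT G' q₀ bQ with hu
  have hun : ‖u‖ = 1 := by rw [hu, ← dist_eq_norm, dist_comm]; exact hzb
  obtain ⟨x, hxx, hinner, hback⟩ := coords_of_unit G' hun
  -- squared distance from `z` to the ball at `b + v` for a model unit offset `v`
  have hdist : ∀ v : Q3, Q3.dot v v = 18 → dist z (TT G' q₀ (Q3.add bQ v)) ^ 2 = 2 - (x 0 * v.x + x 1 * v.y + x 2 * v.z) / 3 := by
    intro v hv
    have e : z - TT G' q₀ (Q3.add bQ v) = u - G' (Qr (iptQ v.toV)) := by rw [TT_add, hu]; abel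
    have hn1 : ‖G' (Qr (iptQ v.toV))‖ ^ 2 = 1 := by
      rw [LinearIsometryEquiv.norm_map, ← real_inner_self_eq_norm_sq, inner_Qr_iptQ, Q3.dq_toV, hv]; norm_num
    rw [dist_eq_norm, e, norm_sub_sq_real, hun, hinner, hn1]
    simp only [Q3.toV, Matrix.cons_val_zero, Matrix.cons_val_one, Matrix.cons_val]
    ring
  -- the three kinds of distance information, as bounds on `S = x·v`
  have gapS : ∀ v : Q3, Q3.dot v v = 18 → 5 / 4 ≤ dist (TT G' q₀ (Q3.add bQ v)) z → x 0 * v.x + x 1 * v.y + x 2 * v.z ≤ 21 / 16 := by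
    intro v hv h
    have hd := hdist v hv
    rw [dist_comm] at h
    nlinarith [h, hd]
  have oneS : ∀ v : Q3, Q3.dot v v = 18 → dist (TT G' q₀ (Q3.add bQ v)) z = 1 → x 0 * v.x + x 1 * v.y + x 2 * v.z = 3 := by
    intro v hv h
    have hd := hdist v hv
    rw [dist_comm] at h
    rw [h] at hd; linarith
  have sepS : ∀ v : Q3, Q3.dot v v = 18 → 1 ≤ dist (TT G' q₀ (Q3.add bQ v)) z → x 0 * v.x + x 1 * v.y + x 2 * v.z ≤ 3 := by
    intro v hv h
    have hd := hdist v hv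
    rw [dist_comm] at h
    nlinarith [h, hd]
  -- K-balls: gap distance (they cannot touch `z`: their contacts of `b` are the ten known balls)
  have hKgap : ∀ k ∈ kList, ∀ v : Q3, Q3.add bQ v = k → Q3.dot v v = 18 → x 0 * v.x + x 1 * v.y + x 2 * v.z ≤ 21 / 16 := by
    intro k hk v hvk hv
    obtain ⟨hkX, hk12, hkc⟩ := hK k hk
    have hkten : k ∈ tenList σ := by simp only [tenList, List.mem_append]; exact Or.inl (Or.inl hk)
    refine gapS v hv ?_
    rw [hvk]
    rcases eq_or_dist_eq_one_or_le_dist_of_saturated hg hX hkX hk12 hz with h | h | h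
    · exact absurd h (hnew k hkten)
    · obtain ⟨w, hw, hzw⟩ := hkc z hz h hzb
      exact absurd hzw (hnew w hw)
    · linarith
  -- S-balls: contact or gap
  have hSalt : ∀ sb ∈ sList σ, ∀ v : Q3, Q3.add bQ v = sb → Q3.dot v v = 18 →
      x 0 * v.x + x 1 * v.y + x 2 * v.z = 3 ∨ x 0 * v.x + x 1 * v.y + x 2 * v.z ≤ 21 / 16 := by
    intro sb hsb v hv18 hv
    obtain ⟨hsX, hs12⟩ := hS sb hsb
    have hsten : sb ∈ tenList σ := by simp only [tenList, List.mem_append]; exact Or.inl (Or.inr hsb)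
    rcases eq_or_dist_eq_one_or_le_dist_of_saturated hg hX hsX hs12 hz with h | h | h
    · exact absurd h (hnew sb hsten)
    · left; exact oneS v hv (by rw [hv18]; exact h)
    · right; exact gapS v hv (by rw [hv18]; linarith)
  -- the mirror ball: separation
  have hmS : ∀ v : Q3, Q3.add bQ v = m0 σ → Q3.dot v v = 18 → x 0 * v.x + x 1 * v.y + x 2 * v.z ≤ 3 := by
    intro v hv18 hv
    have hmten : m0 σ ∈ tenList σ := by simp [tenList]
    refine sepS v hv ?_
    rw [hv18]
    exact hX _ hm _ hz (fun h => hnew _ hmten h.symm)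
  have hσ2 : σ * σ = 1 := by rcases hσ with rfl | rfl <;> norm_num
  have hσR : (σ : ℝ) = 1 ∨ (σ : ℝ) = -1 := by rcases hσ with rfl | rfl <;> norm_num
  have hσ2R : (σ : ℝ) * (σ : ℝ) = 1 := by exact_mod_cast hσ2
  -- the ten constraints
  have cq := hKgap ⟨0, 0, 0⟩ (by simp [kList]) ⟨-3, -3, 0⟩ (by simp [Q3.add, bQ]) (by simp only [Q3.dot]; norm_num)
  have cnA := hKgap ⟨3, 0, 3⟩ (by simp [kList]) ⟨0, -3, 3⟩ (by simp [Q3.add, bQ]) (by simp only [Q3.dot]; norm_num)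
  have cnC := hKgap ⟨3, 0, -3⟩ (by simp [kList]) ⟨0, -3, -3⟩ (by simp [Q3.add, bQ]) (by simp only [Q3.dot]; norm_num)
  have cnB := hKgap ⟨0, 3, 3⟩ (by simp [kList]) ⟨-3, 0, 3⟩ (by simp [Q3.add, bQ]) (by simp only [Q3.dot]; norm_num)
  have cnD := hKgap ⟨0, 3, -3⟩ (by simp [kList]) ⟨-3, 0, -3⟩ (by simp [Q3.add, bQ]) (by simp only [Q3.dot]; norm_num)
  have ceA := hSalt ⟨6, 0, 0⟩ (by simp [sList]) ⟨3, -3, 0⟩ (by simp [Q3.add, bQ]; norm_num) (by simp only [Q3.dot]; norm_num)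
  have ceB := hSalt ⟨0, 6, 0⟩ (by simp [sList]) ⟨-3, 3, 0⟩ (by simp [Q3.add, bQ]; norm_num) (by simp only [Q3.dot]; norm_num)
  have cfA := hSalt ⟨6, 3, 3 * σ⟩ (by simp [sList]) ⟨3, 0, 3 * σ⟩ (by simp [Q3.add, bQ]; norm_num) (by simp only [Q3.dot]; linear_combination 9 * hσ2)
  have cfB := hSalt ⟨3, 6, 3 * σ⟩ (by simp [sList]) ⟨0, 3, 3 * σ⟩ (by simp [Q3.add, bQ]; norm_num) (by simp only [Q3.dot]; linear_combination 9 * hσ2)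
  have cm := hmS ⟨1, 1, -4 * σ⟩ (by simp [Q3.add, bQ, m0]; norm_num) (by simp only [Q3.dot]; linear_combination 16 * hσ2)
  simp only [Rat.cast_neg, Rat.cast_mul, Rat.cast_ofNat, Rat.cast_zero, Rat.cast_one] at cq cnA cnC cnB cnD ceA ceB cfA cfB cm
  have key := free_phys (σ : ℝ) hσR (x 0) (x 1) (x 2) hxx (by linarith) (by linarith) (by linarith) (by linarith) (by linarith)
    (by rcases ceA with h | h <;> [left; right] <;> linarith) (by rcases ceB with h | h <;> [left; right] <;> linarith)
    (by rcases cfA with h | h <;> [left; right] <;> linarith) (by rcases cfB with h | h <;> [left; right] <;> linarith) (by linarith)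
  -- back to the model points
  have hz' : ∀ v : Q3, (∀ i, x i = (((1 : ℚ) / 3) • v.toV) i) → z = TT G' q₀ (Q3.add bQ v) := by
    intro v hv
    have hu' := hback (((1 : ℚ) / 3) • v.toV) hv
    rw [smul_smul, show (3 : ℚ) * (1 / 3) = 1 by norm_num, one_smul] at hu'
    rw [TT_add, ← hu', hu]; abel
  rcases key with ⟨h0, h1, h2⟩ | ⟨h0, h1, h2⟩ | ⟨h0, h1, h2⟩
  · left
    have := hz' ⟨3, 3, 0⟩ (fun i => by fin_cases i <;> simp [Q3.toV, h0, h1, h2])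
    have e : Q3.add bQ ⟨3, 3, 0⟩ = ⟨6, 6, 0⟩ := by simp [Q3.add, bQ]; norm_num
    rw [← e]; exact this
  · right; left
    have := hz' ⟨1, 4, -σ⟩ (fun i => by fin_cases i <;> simp [Q3.toV, h0, h1, h2] <;> ring)
    have e : Q3.add bQ ⟨1, 4, -σ⟩ = ⟨4, 7, -σ⟩ := by simp [Q3.add, bQ]; norm_num
    rw [← e]; exact this
  · right; right
    have := hz' ⟨4, 1, -σ⟩ (fun i => by fin_cases i <;> simp [Q3.toV, h0, h1, h2] <;> ring)
    have e : Q3.add bQ ⟨4, 1, -σ⟩ = ⟨7, 4, -σ⟩ := by simp [Q3.add, bQ]; norm_num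
    rw [← e]; exact this

end FullCensus

end TailResidue

end Summit.Ventures.Crystal3D.Theorems

end
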